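import Summits.ResolutionOfSingularities.ResolutionOfSingularities.Theorems.HilbertSamuelEliminationSigmaMaxModificationsCorridor3WLadderMovingDefs
import HarnessLib

/-!
# [OURS · L1 W4.2] MODULE `Corridor3WLadderMoving` (crux chain w42, helpers v3.6, CHAIN v3.7) — the MOVING W-ladder
# — part 2/3: the PROVED reductions of §1–§3c (calibration, split, joins, drop-in)

PROVENANCE / SPLIT FOR THE GATE (typer res-type-053, res-L1-w42-plan-1 TAKE + TYPING-WANTED 2026-08-27T04:09:15Z): the three
tree modules `…Corridor3WLadderMovingDefs` (every DEFINITION, in the original order), `…Corridor3WLadderMoving` (the PROVED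
reductions of §1–§3c) and `…Corridor3WLadderMovingRows` (the PROVED reductions of §MD) land plan-1's helpers v3.6
`HOME/L/w42/Corridor3WLadderMoving.lean` (sha16 `5411d44e07615426`, 785 l.) with every declaration BYTE-IDENTICAL and in the SAME
namespace `…Theorems.SigmaMaxModificationsCorridor3.Moving` (so the registered stub signatures of skeleton `w_ladder` v5 keep
their constant names): the gate caps Theorems files with proofs at 400 lines and relocates tagged parameterless `def : Prop`s of
Theorems files to Literature/, hence defs are hoisted into the `…Defs` module and the three PARAMETERLESS `Prop`s
`MovingCompactness`, `WA3M`, `WB3M` carry their CJS pointers in prose instead of a `[cite: …]` tag (OURS nodes, not citations of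
print); eight theorems that had no docstring in v3.6 received one-line docstrings (`dirDim_le_geomDirDim`, the six §MD.1
`…M_of_…` transfers, `bridge3SeqM_of_bridge3Seq`). Nothing else differs. `import …Corridor3WLadderMovingRows` gives all three.
idea-2's / plan-1's module docstring follows unchanged.

See `…Corridor3WLadderMovingDefs` for the full module docstring (defect repaired, L∞ proof sketch, references).
OURS (cell res-hironaka, slot W4.2, crux chain w42); NOT statements of the manuscript [Hironaka2017] nor of
[CossartJannsenSaito2020]; AI-drafted, weaker than expert review. Every `theorem` below is PROVED. -/

noncomputable section

-- plan-1/idea-2 module setting kept verbatim (namespace `…Corridor3.Moving` re-enters `…Corridor3`)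
set_option linter.dupNamespace false

open CategoryTheory AlgebraicGeometry TopologicalSpace
open Summit.ResolutionOfSingularities.ResolutionOfSingularities.Theorems.CampaignW42
open Literature.AlgebraicGeometry.Resolution Literature.RingTheory.HilbertSamuel
open Literature.AlgebraicGeometry.CossartJannsenSaito2020
open Summit.ResolutionOfSingularities.ResolutionOfSingularities.Theses.HilbertSamuelElimination
open Summit.ResolutionOfSingularities.ResolutionOfSingularities.Theorems.SigmaMaxModificationsCorridor3

namespace Summit.ResolutionOfSingularities.ResolutionOfSingularities.Theorems.SigmaMaxModificationsCorridor3.Moving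

universe u

variable {R : ∀ S : Scheme.{u}, CentreSeq S → Prop} {N : ℕ} {ν : ℕ → ℕ}

/-! ## §1. L∞ — MOVING COMPACTNESS (typed; provable by the label argument of the module docstring) -/

/-- **No closed point of `X(ν)` starts a MOVING chain ⇒ `S(X, ν)` is not infinite** (given L∞). [folklore] -/
theorem not_canonicalSequenceInfinite_of_forall_noMovingNearChain (hL : MovingCompactness.{u}) {k : Type u} [Field k]
    (hRf : OracleFunctional R) {X : Scheme.{u}} [IsLocallyNoetherian X]
    (hgood : StateGood k R N ν X (Labelling.init X) none)
    (h : ∀ x ∈ Scheme.hsStratum X N ν, IsClosed ({x} : Set X) →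
      NoMovingNearChainFrom R N ν (MarkedStage.init X x) fun _ => True) :
    ¬ CanonicalSequenceInfinite R N ν X := by
  intro hinf
  obtain ⟨x, c, hxstr, hxcl, hc0, hstep, hmov⟩ := hL k R hRf N ν X hgood hinf
  exact h x hxstr hxcl ⟨c, hc0 ▸ Relation.ReflTransGen.refl, hstep, fun _ => trivial, hmov⟩

/-! ## §2. THE MOVING CALIBRATION against Corridor3 (proved: the landed calibration with compactness swapped for L∞) -/

/-- No MOVING chain from the closed points of `X(ν)` + the oracle answers on the strata ⇒ `S(X, ν)` terminates (given L∞).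
[cite: CossartJannsenSaito2020, Rem. 6.29 (1), p. 107] -/
theorem canonicalSequenceTerminates_of_forall_noMovingNearChain (hL : MovingCompactness.{u}) {k : Type u} [Field k]
    (hRf : OracleFunctional R) (hRa : OracleAdmissible R)
    {X : Scheme.{u}} [IsLocallyNoetherian X] (f : X ⟶ Spec (.of k)) [LocallyOfFiniteType f] [QuasiCompact f]
    [IsReduced X] (hdim : topologicalKrullDim X ≤ (N : WithBot ℕ∞)) (hmax : Maximal (· ∈ Scheme.hsValues X N) ν)
    (hν : ν ≠ iterPSum N Phi)
    (htotal : ∀ s : CentreSeq X, s.IsCanonicalRun R N ν → ∀ (Z : Set s.top) (hZ : IsClosed Z),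
      Z ⊆ Scheme.hsStratum s.top N ν → Z.Nonempty →
        ∃ t, R (Scheme.IdealSheafData.vanishingIdeal ⟨Z, hZ⟩).subscheme t)
    (hno : ∀ x ∈ Scheme.hsStratum X N ν, IsClosed ({x} : Set X) →
      NoMovingNearChainFrom R N ν (MarkedStage.init X x) fun _ => True) :
    CanonicalSequenceTerminates R N ν X :=
  have hgood := stateGood_init_general (k := k) hRa f hdim hmax hν
  canonicalSequenceTerminates_of_live_of_not_infinite
    (fun s hs hY => exists_isCanonicalRunFrom_succ_of_total StrictTransformClosedImmersion_holds hgood s hs hY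
      (htotal s hs))
    (not_canonicalSequenceInfinite_of_forall_noMovingNearChain hL hRf hgood hno)

/-- … ⇒ a `ν`-modification `TameWild.NuMod X N d ν` for an arbitrary maximal stratum (universe 0). [cite: CossartJannsenSaito2020, Def. 6.14, Rem. 6.29 (1)] -/
theorem nuMod_of_forall_noMovingNearChain (hL : MovingCompactness.{0}) {R : ∀ S : Scheme.{0}, CentreSeq S → Prop} {N : ℕ}
    {ν : ℕ → ℕ} {k : Type} [Field k] (hRf : OracleFunctional R) (hRa : OracleAdmissible R) {X : Scheme.{0}}
    [IsLocallyNoetherian X] (f : X ⟶ Spec (.of k)) [LocallyOfFiniteType f] [QuasiCompact f] [IsReduced X]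
    (hdimN : topologicalKrullDim X ≤ (N : WithBot ℕ∞)) {d : ℕ} (hdimd : topologicalKrullDim X ≤ (d : WithBot ℕ∞))
    (hmax : Maximal (· ∈ Scheme.hsValues X N) ν) (hν : ν ≠ iterPSum N Phi)
    (htotal : ∀ s : CentreSeq X, s.IsCanonicalRun R N ν → ∀ (Z : Set s.top) (hZ : IsClosed Z),
      Z ⊆ Scheme.hsStratum s.top N ν → Z.Nonempty →
        ∃ t, R (Scheme.IdealSheafData.vanishingIdeal ⟨Z, hZ⟩).subscheme t)
    (hno : ∀ x ∈ Scheme.hsStratum X N ν, IsClosed ({x} : Set X) →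
      NoMovingNearChainFrom R N ν (MarkedStage.init X x) fun _ => True) :
    TameWild.NuMod X N d ν := by
  obtain ⟨s, -, hs⟩ : ∃ s : CentreSeq X, s.IsCanonicalRun R N ν ∧ s.IsNuElimination N ν :=
    exists_isNuElimination_of_canonicalSequenceTerminates
      (canonicalSequenceTerminates_of_forall_noMovingNearChain hL hRf hRa f hdimN hmax hν htotal hno)
      fun t ht => (canonicalCentres_general hRa f hdimN hmax hν t ht).2
  exact TameWild.nuMod_of_isNuElimination f hdimd hdimN hmax s hs

/-- … for threefolds, with the answers from CJS Thm. 1.2. [cite: CossartJannsenSaito2020, Thm. 1.2, Def. 6.14, Rem. 6.29 (1)] -/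
theorem nuMod_threefold_of_noMovingNearChains (hL : MovingCompactness.{0})
    (hCJS : CossartJannsenSaito2020SequencePermissible.{0}) {N : ℕ} {ν : ℕ → ℕ} {k : Type} [Field k] {Y : Scheme.{0}}
    [IsLocallyNoetherian Y] (g : Y ⟶ Spec (.of k)) [LocallyOfFiniteType g] [QuasiCompact g] [IsReduced Y]
    (hdim3 : topologicalKrullDim Y ≤ ((3 : ℕ) : WithBot ℕ∞)) (hdimN : topologicalKrullDim Y ≤ (N : WithBot ℕ∞)) {d : ℕ}
    (hdimd : topologicalKrullDim Y ≤ (d : WithBot ℕ∞)) (hmax : Maximal (· ∈ Scheme.hsValues Y N) ν) (hν : ν ≠ iterPSum N Phi)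
    (hO2 : ∀ R : ∀ S : Scheme.{0}, CentreSeq S → Prop, OracleFunctional R → OracleAdmissible R →
      (∀ S : Scheme.{0}, (∃ t : CentreSeq S, t.AllPermissible ∧ t.CentresOver (Scheme.regularLocus S)ᶜ ∧
        Literature.AlgebraicGeometry.Resolution.Scheme.IsRegular t.top) → ∃ t, R S t) →
      ∀ y ∈ Scheme.hsStratum Y N ν, IsClosed ({y} : Set Y) →
        NoMovingNearChainFrom R N ν (MarkedStage.init Y y) fun _ => True) :
    TameWild.NuMod Y N d ν := by
  obtain ⟨R, hRf, hRa, hRtot⟩ := exists_choiceOracle.{0}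
  exact nuMod_of_forall_noMovingNearChain hL hRf hRa g hdimN hdimd hmax hν
    (fun s hs Z hZ hZν hne => answers_of_dim_le_three_general hCJS hRa hRtot g hdimN hmax hν hdim3 s hs Z hZ hZν hne)
    (hO2 R hRf hRa hRtot)

/-- **THE MOVING CALIBRATION: `SigmaMaxModificationsCorridor3` FROM (A) CJS Thm. 1.2, (L∞) moving compactness, AND (B) «no MOVING
near chain from any closed point of a maximal stratum of a threefold».** Route decl concluded by name through the landed
`TameWild.sigmaMaxModificationsCorridor3_iff` / `hsBody_of_nuMods'`. Conditional (does not close the item): (A) named fact, (L∞) typed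
row, (B) open. [cite: CossartJannsenSaito2020, Thm. 1.2, Def. 6.15, Rem. 6.29 (1), p. 107] -/
theorem sigmaMaxModificationsCorridor3_of_noMovingNearChains (hL : MovingCompactness.{0})
    (hCJS : CossartJannsenSaito2020SequencePermissible.{0})
    (hO2 : ∀ (k : Type) [Field k] (Y : Scheme.{0}) [IsLocallyNoetherian Y] (g : Y ⟶ Spec (.of k))
      [LocallyOfFiniteType g] [QuasiCompact g] [IsReduced Y] (N : ℕ) (ν : ℕ → ℕ),
      topologicalKrullDim Y ≤ ((3 : ℕ) : WithBot ℕ∞) → topologicalKrullDim Y ≤ (N : WithBot ℕ∞) →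
      Maximal (· ∈ Scheme.hsValues Y N) ν → ν ≠ iterPSum N Phi →
      ∀ R : ∀ S : Scheme.{0}, CentreSeq S → Prop, OracleFunctional R → OracleAdmissible R →
        (∀ S : Scheme.{0}, (∃ t : CentreSeq S, t.AllPermissible ∧ t.CentresOver (Scheme.regularLocus S)ᶜ ∧
          Literature.AlgebraicGeometry.Resolution.Scheme.IsRegular t.top) → ∃ t, R S t) →
        ∀ y ∈ Scheme.hsStratum Y N ν, IsClosed ({y} : Set Y) →
          NoMovingNearChainFrom R N ν (MarkedStage.init Y y) fun _ => True) :
    SigmaMaxModificationsCorridor3 := by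
  rw [TameWild.sigmaMaxModificationsCorridor3_iff]
  intro p _ k _ _ X f hsep hft hqc hred hreg _ hd3 N hdN _
  refine TameWild.hsBody_of_nuMods' k N 3 ?_ X f hsep hft hqc hred hreg hd3 hdN
  intro Y g _ hft' hqc' hred' hd3' hdN' ν hν hνΦ
  haveI := hft'
  haveI := hqc'
  haveI := hred'
  haveI : IsLocallyNoetherian Y := LocallyOfFiniteType.isLocallyNoetherian g
  exact nuMod_threefold_of_noMovingNearChains hL hCJS g hd3' hdN' hd3' hν hνΦ
    fun R hRf hRa hRtot => hO2 k Y g N ν hd3' hdN' hν hνΦ R hRf hRa hRtot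

/-! ## §3. The W-rows typed MOVING, and the isolation-recurrence split for moving chains -/

/-- Infinitely-often is shift-invariant. [folklore] -/
theorem io_shift {P : ℕ → Prop} (h : ∀ n, ∃ m, n ≤ m ∧ P m) (n₀ : ℕ) : ∀ n, ∃ m, n ≤ m ∧ P (n₀ + m) := by
  intro n
  obtain ⟨m, hm, hP⟩ := h (n₀ + n)
  exact ⟨m - n₀, by omega, by rwa [show n₀ + (m - n₀) = m by omega]⟩

/-- Dichotomy: eventually-never or infinitely-often. [folklore] -/
theorem eventually_not_or_io (P : ℕ → Prop) : (∃ n₀, ∀ n, n₀ ≤ n → ¬ P n) ∨ (∀ n, ∃ m, n ≤ m ∧ P m) := by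
  by_cases h : ∀ n, ∃ m, n ≤ m ∧ P m
  · exact Or.inr h
  · left; push Not at h; exact h

/-- **THE SPLIT for moving chains (proved).** [folklore] -/
theorem noMovingNearChainFrom_iff_recurrence {s₀ : MarkedStage.{u}} {G : MarkedStage.{u} → Prop} (B : MarkedStage.{u} → Prop) :
    NoMovingNearChainFrom R N ν s₀ G ↔
      (NoMovingNearChainFrom R N ν s₀ fun s => G s ∧ ¬ B s) ∧ NoMovingRecurrentNearChainFrom R N ν s₀ G B := by
  constructor
  · intro h
    refine ⟨?_, ?_⟩
    · rintro ⟨c, h0, hstep, hG, hmov⟩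
      exact h ⟨c, h0, hstep, fun n => (hG n).1, hmov⟩
    · rintro ⟨c, h0, hstep, hG, hmov, -⟩
      exact h ⟨c, h0, hstep, hG, hmov⟩
  · rintro ⟨htail, hrec⟩ ⟨c, h0, hstep, hG, hmov⟩
    rcases eventually_not_or_io (fun n => B (c n)) with ⟨n₀, hn₀⟩ | hio
    · exact htail ⟨fun n => c (n₀ + n), reaches_chain h0 hstep n₀, fun n => hstep (n₀ + n),
        fun n => ⟨hG _, hn₀ _ (Nat.le_add_right _ _)⟩, io_shift hmov n₀⟩
    · exact hrec ⟨c, h0, hstep, hG, hmov, hio⟩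

/-- The split at row level (proved). [folklore] -/
theorem maxOriginNoMovingNearChainAt_of_recurrence {p N : ℕ} {G B : MarkedStage.{u} → Prop}
    (htail : MaxOriginNoMovingNearChainAt p N fun s => G s ∧ ¬ B s) (hrec : MaxOriginNoMovingRecurrentNearChainAt p N G B) :
    MaxOriginNoMovingNearChainAt p N G :=
  fun R hRf hRa ν X _ x hX =>
    (noMovingNearChainFrom_iff_recurrence B).2 ⟨htail R hRf hRa ν X x hX, hrec R hRf hRa ν X x hX⟩

/-- The grade join for moving rows: low ∧ top ⇒ all grades (for the calibration's `fun _ => True`). [folklore] -/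
theorem maxOriginNoMovingNearChainAt_all_of_grades {p N : ℕ}
    (hlow : MaxOriginNoMovingNearChainAt.{u} p N fun s => s.geomDirDim ≤ 2)
    (htop : MaxOriginNoMovingNearChainAt.{u} p N fun s => 3 ≤ s.geomDirDim)
    (hmono : ∀ (R : ∀ S : Scheme.{u}, CentreSeq S → Prop), OracleFunctional R → OracleAdmissible R →
      ∀ (ν : ℕ → ℕ) (s s' : MarkedStage.{u}), CanonicalNearStep R N ν s s' → s'.geomDirDim ≤ s.geomDirDim) :
    MaxOriginNoMovingNearChainAt.{u} p N fun _ => True := by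
  intro R hRf hRa ν X _ x hX
  rintro ⟨c, h0, hstep, -, hmov⟩
  -- the grade `ē` is non-increasing along the chain: either it is eventually `≤ 2`, or it is `≥ 3` throughout
  rcases eventually_not_or_io (fun n => 3 ≤ (c n).geomDirDim) with ⟨n₀, hn₀⟩ | hio
  · refine hlow R hRf hRa ν X x hX ⟨fun n => c (n₀ + n), reaches_chain h0 hstep n₀, fun n => hstep (n₀ + n),
      fun n => ?_, io_shift hmov n₀⟩
    have := hn₀ (n₀ + n) (Nat.le_add_right _ _)
    show (c (n₀ + n)).geomDirDim ≤ 2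
    omega
  · have hanti : ∀ n k, (c (n + k)).geomDirDim ≤ (c n).geomDirDim := by
      intro n k
      induction k with
      | zero => exact le_rfl
      | succ k ih => exact (hmono R hRf hRa ν (c (n + k)) (c (n + k + 1)) (hstep (n + k))).trans ih
    refine htop R hRf hRa ν X x hX ⟨c, h0, hstep, fun n => ?_, hmov⟩
    obtain ⟨m, hnm, h3⟩ := hio n
    have := hanti n (m - n)
    rw [show n + (m - n) = m by omega] at this
    exact h3.trans this

/-! ### §3a. The splitting predicate and the rows of round 3, MOVING -/

/-- `e ≤ ē` at the marked point (tree `Scheme.dirDim_le_geomDirDim`). -/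
theorem dirDim_le_geomDirDim (s : MarkedStage.{u}) : dirDim s ≤ s.geomDirDim :=
  @Scheme.dirDim_le_geomDirDim s.W s.ln s.pt

/-- JOIN (proved). [folklore] -/
theorem wlowM_of_units_strata {P : ℕ → Prop} (hU : ∀ p, P p → WlowUnitsM p) (hS : ∀ p, P p → WlowStrataM p) :
    ∀ p, P p → WlowM p :=
  fun p hp => maxOriginNoMovingNearChainAt_of_recurrence (hS p hp) (hU p hp)

/-- **PROVED REDUCTION (moving): UNITS-half from F-key (isolated, print-faithful `KeyTheorem640_char_isolated`) + the two pieces.**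
[cite: CossartJannsenSaito2020, Thm. 6.40, Cor. 6.37] -/
theorem wlowUnitsM_of_extraction {p : ℕ} (hK : KeyTheorem640_char_isolated.{0})
    (hlow : IsoLowDirDimTerminatesM p) (hext : UnitTowerExtractionM p) : WlowUnitsM p := by
  intro R hRf hRa ν X _ x hX
  rintro ⟨c, h0, hstep, hG, hmov, hrec⟩
  by_cases hlowstage : ∃ m, Iso 3 (c m) ∧ dirDim (c m) ≤ 1
  · obtain ⟨m, hiso, hdir⟩ := hlowstage
    have hscope : InScopeM p R 3 ν (c m) := ⟨X, ‹_›, x, hX, reaches_chain h0 hstep m⟩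
    exact hlow R hRf hRa ν (c m) hscope hiso hdir
      ⟨fun n => c (m + n), Relation.ReflTransGen.refl, fun n => hstep (m + n), fun _ => trivial, io_shift hmov m⟩
  · push Not at hlowstage
    have he : ∀ n, Iso 3 (c n) → dirDim (c n) = 2 ∧ (c n).geomDirDim = 2 := by
      intro n hiso
      have h1 := hlowstage n hiso
      have h2 := dirDim_le_geomDirDim (c n)
      have h3 := hG n
      exact ⟨by omega, by omega⟩
    obtain ⟨T, len, pt, hset, hchar, hchain, hisoT⟩ := hext R hRf hRa ν X x hX c h0 hstep hG hmov hrec he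
    exact hK T 3 len pt hset hchar hchain hisoT

/-- **W-low MOVING assembled** from the three pieces + the strata-half, under any side condition `P` on `p`. [folklore] -/
theorem wlowM_assembled {P : ℕ → Prop} (hK : KeyTheorem640_char_isolated.{0}) (hlow : ∀ p, P p → IsoLowDirDimTerminatesM p)
    (hext : ∀ p, P p → UnitTowerExtractionM p) (hS : ∀ p, P p → WlowStrataM p) : ∀ p, P p → WlowM p :=
  wlowM_of_units_strata (fun p hp => wlowUnitsM_of_extraction hK (hlow p hp) (hext p hp)) hS

/-! ### §3b. The old rows imply the moving ones (so nothing proved for the old typing is lost) -/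

/-- `NoNearChainFrom`-rows imply the moving rows. [folklore] -/
theorem maxOriginNoMovingNearChainAt_of_noNearChain {p N : ℕ} {G : MarkedStage.{u} → Prop}
    (h : ∀ (R : ∀ S : Scheme.{u}, CentreSeq S → Prop), OracleFunctional R → OracleAdmissible R →
      ∀ (ν : ℕ → ℕ) (X : Scheme.{u}) [IsLocallyNoetherian X] (x : X), IsMaximalOrigin p N ν X x →
        NoNearChainFrom R N ν (MarkedStage.init X x) G) :
    MaxOriginNoMovingNearChainAt p N G :=
  fun R hRf hRa ν X _ x hX => (h R hRf hRa ν X x hX).noMoving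

section DropIn

open Summit.ResolutionOfSingularities.ResolutionOfSingularities.Theorems.SigmaMaxModificationsCorridor3.Helpers
  (InScopeC ClosedOriginNoNearChainAt ClosedOriginGeomDirDimNonincrease WFair WA3 WB3)

/-! ### §3c. DROP-IN for the line of record `w_ladder` v4 (landed modules `…Corridor3WLadderDefs` / `…Corridor3WLadder`,
ns `…Theorems.SigmaMaxModificationsCorridor3.Helpers`): v4 row = MOVING row + `WFair` (proved both ways round), and the MOVING
versions `WA3M` / `WB3M` of `WA3` / `WB3` with `WA3M_of_CJS` (mod L∞), `WB3M_of_rows`, `nuMod_three_of_WAM_WBM` — same downstream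
interface as `Helpers.nuMod_three_of_WA_WB`. -/

/-- A v4 row (`ClosedOriginNoNearChainAt`) implies the moving row. [folklore] -/
theorem maxOriginNoMovingNearChainAt_of_closedOrigin {p N : ℕ} {G : MarkedStage.{u} → Prop}
    (h : ClosedOriginNoNearChainAt.{u} p N G) : MaxOriginNoMovingNearChainAt.{u} p N G :=
  fun R hRf hRa ν X _ x hX => (h R hRf hRa ν X x hX).noMoving

/-- **v4 row = MOVING row + `WFair`**: under plan-1's fairness row, the moving row gives back the v4 row — so `WFair` is EXACTLY
the part of each v4 row that is hostage to the other lineages (and L∞ replaces it on the calibration side). [folklore] -/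
theorem closedOriginNoNearChainAt_of_wfair_of_moving {p N : ℕ} {G : MarkedStage.{u} → Prop} (hfair : WFair.{u} p N)
    (hM : MaxOriginNoMovingNearChainAt.{u} p N G) : ClosedOriginNoNearChainAt.{u} p N G := by
  intro R hRf hRa ν X _ x hX
  rintro ⟨c, h0, hstep, hG⟩
  refine hM R hRf hRa ν X x hX ⟨c, h0, hstep, hG, fun n => ?_⟩
  obtain ⟨m, hnm, hni⟩ := hfair R hRf hRa ν X x hX c h0 hstep n
  refine ⟨m, hnm, ?_⟩
  obtain ⟨C, P', h, x', hcs, hπ, -, -, hs'⟩ := hstep m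
  by_contra hnot
  exact hni ⟨C, P', h, x', hcs, hπ, hs', fun hmem => hnot ⟨C, P', hcs, hmem⟩⟩

/-- **WA, moving, PROVED modulo CJS Thm. 1.2 and L∞.** [cite: CossartJannsenSaito2020, Thm. 1.2, Rem. 6.29 (1)] -/
theorem WA3M_of_CJS (hL : MovingCompactness.{0}) (hCJS : CossartJannsenSaito2020SequencePermissible.{0}) : WA3M := by
  intro p _ hT k _ _ Y g _ hft hqc hred hdim ν hmax hne
  haveI := hft
  haveI := hqc
  haveI := hred
  haveI : IsLocallyNoetherian Y := LocallyOfFiniteType.isLocallyNoetherian g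
  exact nuMod_threefold_of_noMovingNearChains hL hCJS g hdim hdim hdim hmax hne fun R hRf hRa _ y hy hyc =>
    hT R hRf hRa ν Y y ⟨⟨k, inferInstance, inferInstance, g, ‹_›, hft, hqc⟩, hred, hdim, hmax, hyc, hy⟩

/-- The moving grade join against plan-1's in-scope W-mono row. [folklore] -/
theorem maxOriginNoMovingNearChainAt_all_of_grades' {p N : ℕ} (hmono : ClosedOriginGeomDirDimNonincrease.{u} p N)
    (hlow : MaxOriginNoMovingNearChainAt.{u} p N fun s => s.geomDirDim ≤ 2)
    (htop : MaxOriginNoMovingNearChainAt.{u} p N fun s => 3 ≤ s.geomDirDim) :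
    MaxOriginNoMovingNearChainAt.{u} p N fun _ => True := by
  intro R hRf hRa ν X _ x hX
  rintro ⟨c, h0, hstep, -, hmov⟩
  have hscope : ∀ n, InScopeC p R N ν (c n) := fun n => ⟨X, ‹_›, x, hX, reaches_chain h0 hstep n⟩
  rcases eventually_not_or_io (fun n => 3 ≤ (c n).geomDirDim) with ⟨n₀, hn₀⟩ | hio
  · refine hlow R hRf hRa ν X x hX ⟨fun n => c (n₀ + n), reaches_chain h0 hstep n₀, fun n => hstep (n₀ + n),
      fun n => ?_, io_shift hmov n₀⟩
    have := hn₀ (n₀ + n) (Nat.le_add_right _ _)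
    show (c (n₀ + n)).geomDirDim ≤ 2
    omega
  · have hanti : ∀ n k, (c (n + k)).geomDirDim ≤ (c n).geomDirDim := by
      intro n k
      induction k with
      | zero => exact le_rfl
      | succ k ih => exact (hmono R hRf hRa ν (c (n + k)) (c (n + k + 1)) (hscope _) (hstep (n + k))).trans ih
    refine htop R hRf hRa ν X x hX ⟨c, h0, hstep, fun n => ?_, hmov⟩
    obtain ⟨m, hnm, h3⟩ := hio n
    have := hanti n (m - n)
    rw [show n + (m - n) = m by omega] at this
    exact h3.trans this

/-- **WB, moving, from the moving graded rows** (W-mono as in plan-1's row). [folklore] -/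
theorem WB3M_of_rows (hmono : ∀ p : ℕ, p.Prime → ClosedOriginGeomDirDimNonincrease.{0} p 3)
    (hlow : ∀ p : ℕ, p.Prime → WlowM p) (htop : ∀ p : ℕ, p.Prime → WtopM p) : WB3M :=
  fun p hp => maxOriginNoMovingNearChainAt_all_of_grades' (hmono p hp) (hlow p hp) (htop p hp)

/-- **`nuMod_three` from the MOVING WA and WB** — the same statement as `Helpers.nuMod_three_of_WA_WB`, so the v4 composition
downstream of it is untouched. [cite: CossartJannsenSaito2020, Rem. 6.29, Def. 6.14] -/
theorem nuMod_three_of_WAM_WBM (hA : WA3M) (hB : WB3M) (p : ℕ) (hp : p.Prime) (k : Type) [Field k] [CharP k p] :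
    ∀ (Y : Scheme.{0}) (g : Y ⟶ Spec (.of k)), IsSeparated g → LocallyOfFiniteType g →
      QuasiCompact g → IsReduced Y → topologicalKrullDim Y ≤ ((3 : ℕ) : WithBot ℕ∞) →
      topologicalKrullDim Y ≤ ((3 : ℕ) : WithBot ℕ∞) →
      ∀ ν : ℕ → ℕ, Maximal (· ∈ Scheme.hsValues Y 3) ν → ν ≠ iterPSum 3 Phi → TameWild.NuMod Y 3 3 ν :=
  fun Y g hsep hft hqc hred hd3 _ ν hν hνΦ => hA p hp (hB p hp) k Y g hsep hft hqc hred hd3 ν hν hνΦ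

/-- The v4 statements imply the moving ones (nothing proved for v4 is lost). [folklore] -/
theorem WB3M_of_WB3 (h : WB3) : WB3M := fun p hp => maxOriginNoMovingNearChainAt_of_closedOrigin (h p hp)

end DropIn

end Summit.ResolutionOfSingularities.ResolutionOfSingularities.Theorems.SigmaMaxModificationsCorridor3.Moving

end
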